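import Literature.AlgebraicGeometry.HodgeTheory.WeilClassesFieldRationalSpan
import Literature.AlgebraicGeometry.HodgeTheory.AbelianVarietyPullbackAlgebraicClasses
import Literature.AlgebraicGeometry.Deligne1982.WeilSpaceDimension
import HarnessLib

/-!
# One non-zero rational algebraic Weil class suffices: `W_F ⊗ ℂ ≤ algebraicClasses` for a field `F ⊂ End⁰(A)`
# of ANY degree (Moonen–Zarhin §1 «`dim_F W_F = 1`»; Markman, arXiv:2509.23403 §4)

Layer `Literature/AlgebraicGeometry/HodgeTheory`, theorem-only companion of `WeilClassesMoonenZarhinCriterion`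
(`weilClassesField A φ P r = ⨆_{P(ρ)=0} ⋀ʳ V_{ℂ,ρ} ⊆ Hʳ(A(ℂ); ℂ)`, the complexified space of Weil classes of a complex
abelian variety `A` relative to the field `F = ℚ(φ) ≅ ℚ[T]/(P)`), of `WeilClassesFieldRationalSpan` (descent) and of
`Deligne1982/WeilSpaceDimension` (`dim_ℂ = e`). Everything is proved; no definition, no named fact (D-0026).

THE PRINTED SENTENCE (E. Markman, *Secant sheaves and Weil classes on abelian varieties*, arXiv:2509.23403, §4 pp. 9–10 (the
sentence is at the top of PDF p. 10: v1 lines 2–5 = v2 lines 7–10), for a CM field `K`, `HW(A,η) = ∧^d_K H¹(A,ℚ)`): «The class `γ` remains algebraic […]. Now `K` acts on `H^*(A,ℚ)` via algebraic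
correspondences and `HW(A,η′)` is 1-dimensional over `K`. Hence every class in `HW(A,η′)` is algebraic.» Moonen–Zarhin,
Crelle 496 (1998) §1: «The 1-dimensional `F`-vector space `W_F = W_F(X) := ⋀^r_F V_X`», `r = 2g/[F:ℚ]`. The quadratic
case (`e = 2`, even without rationality of `γ`) is the tree's `weilClassesOf_le_algebraicClasses_iff_exists_ne_zero`.

* `weilClassesField_le_algebraicClasses_of_isRationalClass_of_ne_zero` — for `φ : A ⟶ A`, `P ∈ ℤ[T]` irreducible over
  `ℚ` of degree `e` with `P(φ) = 0`, `r = 2m > 0`, `e · r = 2 dim A`: ONE non-zero RATIONAL algebraic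
  `γ ∈ weilClassesField A φ P r` ⟹ `weilClassesField A φ P r ≤ algebraicClasses A.X m`;
  `weilClassesField_le_algebraicClasses_of_kappa` — the same from rational algebraic `κ`, `δ` with `κ − δ ∈ W ∖ 0`.

## Proof

With a separating test endomorphism `x₀·𝟙 + φ` (`exists_nat_separating_prod`: `ρ ↦ (x₀ + ρ)ʳ` injective on the roots
of `P`) and the irreducible `M = minpoly_ℚ((x₀ + T)ʳ) ∈ ℚ[X]` over `K = ℚ[T]/(P)`, the rational operator
`T₀ = (x₀·𝟙 + φ)^*` satisfies `M(T₀) = 0` on `W = W_F ⊗ ℂ` (each summand `⋀ʳ V_ρ` is a `T₀`-eigenspace for a root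
`(x₀ + ρ)ʳ` of `M`, `aeval_minpoly_pow_eq_zero`). Hence the annihilator of `γ` in `ℚ[X]` is the maximal ideal `(M)`
(Bézout), so the `s = deg M` rational classes `γ, T₀γ, …, T₀^{s-1}γ` are `ℚ`-, hence `ℂ`-linearly independent (a
complex relation among rational classes has rational shadows, `sum_dual_smul_eq_zero_of_isRationalClass`; duals separate
points, `Module.forall_dual_apply_eq_zero_iff`). They lie in `W` (stable under test pull-backs) and are algebraic
(pull-back along an endomorphism of an abelian variety preserves algebraic classes,
`map_mem_algebraicClasses_of_abelianVariety`, Fulton Cor. 19.2 (b)). Finally `s ≥ e`: the `e` distinct numbers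
`(x₀ + ρ)ʳ` are roots of `M`; and `dim_ℂ W = e` (`Deligne1982.finrank_weilClassesField_eq_natDegree`). So their span is
all of `W`, and `W ≤ algebraicClasses`. ∎

## References

* [Markman2025SurveySecant] E. Markman, arXiv:2509.23403 (2025), §4 pp. 9–10 (the quoted sentence: PDF p. 10, v1 L2–5 = v2 L7–10),
  §12 p. 21 (both arXiv versions; "p. 20" was the held corpus chunk p0020).
* [MoonenZarhin1998WeilClasses] B. J. J. Moonen, Yu. G. Zarhin, J. reine angew. Math. 496 (1998) 83–92, §1.
* [Deligne1982HodgeCycles] P. Deligne (notes by J. S. Milne), LNM 900 (1982), §4 (4.4), p. 30.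
* [Fulton1998] W. Fulton, *Intersection Theory*, Cor. 19.2 (b). [HatcherAT2002] A. Hatcher, §3.1 p. 198.
* [vanGeemen1994HodgeAV] B. van Geemen, LNM 1594 (1994), 4.9, proof of Thm. 6.12 (the quadratic case).
-/

noncomputable section

open CategoryTheory Polynomial Module

namespace Literature.AlgebraicGeometry.HodgeTheory

open Literature.AlgebraicGeometry.Motives (AbelianVariety IsSmoothProjective)
open Literature.AlgebraicGeometry.Deligne1982 (finrank_weilClassesField_eq_natDegree)
open Literature.AlgebraicTopology.SingularHomology

section HodgeTheory

section OneClass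

variable {A : AbelianVariety ℂ}

/-- Pull-backs along endomorphisms of an abelian variety, iterated, preserve algebraic classes (Fulton Cor. 19.2 (b),
the tree's `map_mem_algebraicClasses_of_abelianVariety`). [cite: Fulton1998, §19.2 Cor. 19.2 (b)] -/
theorem pow_hom_complexBetti_map_mem_algebraicClasses (g : A.X ⟶ A.X) {p : ℕ} (j : ℕ)
    {c : complexBetti A.X (2 * p)} (hc : c ∈ algebraicClasses A.X p) :
    ((complexBetti.map g (2 * p)).hom ^ j) c ∈ algebraicClasses A.X p := by
  induction j generalizing c with
  | zero => rwa [pow_zero, Module.End.one_apply]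
  | succ j ih =>
    rw [pow_succ, Module.End.mul_apply]
    exact ih (map_mem_algebraicClasses_of_abelianVariety
      (Motives.AbelianVariety.isSmoothProjective_holds (A := A)) A g hc)

/-- Each summand `⋀ʳ V_ρ = pullbackEigenclasses A φ r ((x + yρ)ʳ)` is stable under every test pull-back
`(x·𝟙 + y·φ)^*` (it acts there by the scalar `(x + yρ)ʳ`). [cite: MoonenZarhin1998WeilClasses, §1] -/
theorem hom_complexBetti_map_mem_pullbackEigenclasses {φ : A ⟶ A} {r : ℕ} {ρ : ℂ} (x y : ℕ)
    {c : complexBetti A.X r}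
    (hc : c ∈ pullbackEigenclasses A φ r (fun x y => ((x : ℂ) + (y : ℂ) * ρ) ^ r)) :
    (complexBetti.map (x • 𝟙 A + y • φ).hom.hom.hom r).hom c ∈
      pullbackEigenclasses A φ r (fun x y => ((x : ℂ) + (y : ℂ) * ρ) ^ r) := by
  have h : (complexBetti.map (x • 𝟙 A + y • φ).hom.hom.hom r).hom c = (((x : ℂ) + (y : ℂ) * ρ) ^ r) • c :=
    (mem_pullbackEigenclasses_iff.1 hc) x y
  rw [h]
  exact Submodule.smul_mem _ _ hc

/-- `W_F ⊗ ℂ = ⨆_ρ ⋀ʳ V_ρ` is stable under every test pull-back `(x·𝟙 + y·φ)^*`.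
[cite: MoonenZarhin1998WeilClasses, §1] -/
theorem hom_complexBetti_map_mem_weilClassesField {φ : A ⟶ A} {P : Polynomial ℤ} {r : ℕ} (x y : ℕ)
    {c : complexBetti A.X r} (hc : c ∈ weilClassesField A φ P r) :
    (complexBetti.map (x • 𝟙 A + y • φ).hom.hom.hom r).hom c ∈ weilClassesField A φ P r := by
  have hle : (weilClassesField A φ P r).map (complexBetti.map (x • 𝟙 A + y • φ).hom.hom.hom r).hom ≤
      weilClassesField A φ P r := by
    unfold weilClassesField
    rw [Submodule.map_iSup]
    refine iSup_le fun ρ => ?_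
    rw [Submodule.map_iSup]
    refine iSup_le fun hρ => ?_
    refine le_trans ?_ (pullbackEigenclasses_le_weilClassesField hρ)
    rintro _ ⟨c', hc', rfl⟩
    exact hom_complexBetti_map_mem_pullbackEigenclasses x y hc'
  exact hle ⟨c, hc, rfl⟩

/-- … hence under all powers of one test pull-back. [cite: MoonenZarhin1998WeilClasses, §1] -/
theorem pow_hom_complexBetti_map_mem_weilClassesField {φ : A ⟶ A} {P : Polynomial ℤ} {r : ℕ} (x y : ℕ)
    (j : ℕ) {c : complexBetti A.X r} (hc : c ∈ weilClassesField A φ P r) :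
    ((complexBetti.map (x • 𝟙 A + y • φ).hom.hom.hom r).hom ^ j) c ∈ weilClassesField A φ P r := by
  induction j generalizing c with
  | zero => rwa [pow_zero, Module.End.one_apply]
  | succ j ih =>
    rw [pow_succ, Module.End.mul_apply]
    exact ih (hom_complexBetti_map_mem_weilClassesField x y hc)

/-- On `W_F ⊗ ℂ` the operator `M((x₀·𝟙 + φ)^*)` vanishes for every `M ∈ ℚ[X]` with all `(x₀ + ρ)ʳ`, `P(ρ) = 0`, among
its roots (each summand `⋀ʳ V_ρ` is an eigenspace of `(x₀·𝟙 + φ)^*`). [cite: MoonenZarhin1998WeilClasses, §1] -/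
theorem aeval_hom_complexBetti_map_eq_zero_of_mem_weilClassesField {φ : A ⟶ A} {P : Polynomial ℤ} {r : ℕ}
    (x₀ : ℕ) {M : Polynomial ℚ}
    (hM : ∀ ρ : ℂ, Polynomial.eval₂ (Int.castRingHom ℂ) ρ P = 0 →
      (M.map (algebraMap ℚ ℂ)).eval (((x₀ : ℂ) + ρ) ^ r) = 0)
    {c : complexBetti A.X r} (hc : c ∈ weilClassesField A φ P r) :
    aeval (complexBetti.map (x₀ • 𝟙 A + 1 • φ).hom.hom.hom r).hom (M.map (algebraMap ℚ ℂ)) c = 0 := by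
  set T₀ : Module.End ℂ (complexBetti A.X r) := (complexBetti.map (x₀ • 𝟙 A + 1 • φ).hom.hom.hom r).hom
  have hker : weilClassesField A φ P r ≤ LinearMap.ker (aeval T₀ (M.map (algebraMap ℚ ℂ))) := by
    refine iSup₂_le fun ρ hρ => ?_
    intro c hc
    rw [LinearMap.mem_ker]
    have hcT : T₀ c = (((x₀ : ℂ) + ρ) ^ r) • c := by
      have h := (mem_pullbackEigenclasses_iff.1 hc) x₀ 1
      simp only [Nat.cast_one, one_mul] at h
      exact h
    by_cases hc0 : c = 0
    · rw [hc0, map_zero]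
    · rw [Module.End.aeval_apply_of_hasEigenvector
        (Module.End.hasEigenvector_iff.2 ⟨Module.End.mem_eigenspace_iff.2 hcT, hc0⟩), hM ρ hρ, zero_smul]
  exact LinearMap.mem_ker.1 (hker hc)

/-- Arithmetic of the separating test endomorphism: there is `x₀ ∈ ℕ` such that `ρ ↦ (x₀ + ρ)ʳ` is INJECTIVE on the
complex roots of `P` (`r ≠ 0`; a special case of `exists_nat_separating_prod`). [folklore] -/
private theorem exists_nat_pow_add_injOn (Z : Finset ℂ) {r : ℕ} (hr : r ≠ 0) :
    ∃ x₀ : ℕ, Set.InjOn (fun ρ : ℂ => ((x₀ : ℂ) + ρ) ^ r) (Z : Set ℂ) := by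
  classical
  obtain ⟨x₀, hsep⟩ := exists_nat_separating_prod (N := Z.card) (fun i => (Z.equivFin.symm i : ℂ)) Z r
  refine ⟨x₀, fun ρ hρ ρ' hρ' h => ?_⟩
  let i : Fin r := ⟨0, Nat.pos_of_ne_zero hr⟩
  have h' : ∏ _j : Fin r, ((x₀ : ℂ) + (Z.equivFin.symm (Z.equivFin ⟨ρ, hρ⟩) : ℂ)) = ((x₀ : ℂ) + ρ') ^ r := by
    rw [Finset.prod_const, Finset.card_univ, Fintype.card_fin, Equiv.symm_apply_apply]
    exact h
  have := hsep (fun _ => Z.equivFin ⟨ρ, hρ⟩) ρ' hρ' h' i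
  rwa [Equiv.symm_apply_apply] at this

/-- **THE ONE-CLASS LEMMA ([Mar25b] §4, last two sentences; Moonen–Zarhin §1 «the 1-dimensional `F`-vector space
`W_F`»).** Let `A` be a complex abelian variety, `φ : A ⟶ A` with `P(φ) = 0` in `End A` for `P ∈ ℤ[T]` irreducible over
`ℚ` of degree `e` (`F = ℚ(φ) ≅ ℚ[T]/(P) ⊂ End⁰(A)`), and `r = 2m > 0` with `e · r = 2 dim A` (`r = dim_F H¹(A,ℚ)`,
`W_F = ⋀ʳ_F H¹` an `F`-line). If `W_F ⊗ ℂ = weilClassesField A φ P r` contains ONE non-zero RATIONAL algebraic class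
`γ`, then EVERY class of `W_F ⊗ ℂ` is algebraic: «`K` acts on `H^*(A,ℚ)` via algebraic correspondences and `HW(A,η′)`
is 1-dimensional over `K`. Hence every class in `HW(A,η′)` is algebraic.» Proof in the module docstring.
[cite: Markman2025SurveySecant, §4 (the paragraph after conditions (a)–(c), pp. 9–10)]
[cite: MoonenZarhin1998WeilClasses, §1 (dim_F W_F = 1; W_F ⊗ ℂ = ⊕_σ ⋀^r V_{ℂ,σ})]
[cite: Deligne1982HodgeCycles, §4 (4.4) and p. 30] [cite: Fulton1998, §19.2 Cor. 19.2 (b)] -/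
theorem weilClassesField_le_algebraicClasses_of_isRationalClass_of_ne_zero {φ : A ⟶ A} {P : Polynomial ℤ}
    {e m : ℕ} (hPe : P.natDegree = e) (hPirr : Irreducible (P.map (Int.castRingHom ℚ)))
    (hφ : Polynomial.eval₂ (Int.castRingHom (CategoryTheory.End A)) (φ : CategoryTheory.End A) P = 0)
    (her : e * (2 * m) = 2 * A.dim) (hm : 0 < m)
    {γ : complexBetti A.X (2 * m)} (hγW : γ ∈ weilClassesField A φ P (2 * m)) (hγQ : IsRationalClass γ)
    (hγ0 : γ ≠ 0) (hγalg : γ ∈ algebraicClasses A.X m) :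
    weilClassesField A φ P (2 * m) ≤ algebraicClasses A.X m := by
  classical
  have hX : IsSmoothProjective A.dim A.X := Motives.AbelianVariety.isSmoothProjective_holds (A := A)
  haveI := finite_complexBetti_abelianVariety A (2 * m)
  have hr : 2 * m ≠ 0 := by omega
  have hP0 : P ≠ 0 := fun h => hPirr.ne_zero (by rw [h, Polynomial.map_zero])
  let Z : Finset ℂ := (P.map (Int.castRingHom ℂ)).roots.toFinset
  have hZ : ∀ μ, μ ∈ Z ↔ Polynomial.eval₂ (Int.castRingHom ℂ) μ P = 0 := mem_roots_toFinset_map_iff hP0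
  have hsepC : (P.map (Int.castRingHom ℂ)).Separable := by
    rw [map_castRingHom_complex_eq]; exact hPirr.separable.map
  have hZcard : Z.card = e := by
    rw [Multiset.toFinset_card_of_nodup (nodup_roots hsepC),
      ← (IsAlgClosed.splits (P.map (Int.castRingHom ℂ))).natDegree_eq_card_roots,
      natDegree_map_eq_of_injective (RingHom.injective_int (Int.castRingHom ℂ)), hPe]
  obtain ⟨x₀, hinj⟩ := exists_nat_pow_add_injOn Z hr
  set T₀ : Module.End ℂ (complexBetti A.X (2 * m)) :=
    (complexBetti.map (x₀ • 𝟙 A + 1 • φ).hom.hom.hom (2 * m)).hom with hT₀def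
  -- `M = minpoly_ℚ ((x₀ + T)ʳ)` over `ℚ[T]/(P)`: irreducible, kills `W_F ⊗ ℂ`, has the `e` distinct roots `(x₀ + ρ)ʳ`
  haveI : Fact (Irreducible (P.map (Int.castRingHom ℚ))) := ⟨hPirr⟩
  haveI : FiniteDimensional ℚ (AdjoinRoot (P.map (Int.castRingHom ℚ))) :=
    (AdjoinRoot.powerBasis hPirr.ne_zero).finite
  let g : AdjoinRoot (P.map (Int.castRingHom ℚ)) :=
    ((x₀ : AdjoinRoot (P.map (Int.castRingHom ℚ))) + AdjoinRoot.root (P.map (Int.castRingHom ℚ))) ^ (2 * m)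
  let M : Polynomial ℚ := minpoly ℚ g
  have hMirr : Irreducible M := minpoly.irreducible (Algebra.IsIntegral.isIntegral g)
  have hM0 : M ≠ 0 := hMirr.ne_zero
  have hMroot : ∀ ρ, Polynomial.eval₂ (Int.castRingHom ℂ) ρ P = 0 →
      (M.map (algebraMap ℚ ℂ)).eval (((x₀ : ℂ) + ρ) ^ (2 * m)) = 0 := by
    intro ρ hρ
    rw [Polynomial.eval_map, ← aeval_def]; exact aeval_minpoly_pow_eq_zero P x₀ (2 * m) hρ
  have hMW : ∀ c ∈ weilClassesField A φ P (2 * m), aeval T₀ (M.map (algebraMap ℚ ℂ)) c = 0 :=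
    fun c hc => aeval_hom_complexBetti_map_eq_zero_of_mem_weilClassesField x₀ hMroot hc
  have heM : e ≤ M.natDegree := by
    have hM'0 : M.map (algebraMap ℚ ℂ) ≠ 0 := (Polynomial.map_ne_zero_iff (algebraMap ℚ ℂ).injective).2 hM0
    have himg : Z.image (fun ρ : ℂ => ((x₀ : ℂ) + ρ) ^ (2 * m)) ⊆ (M.map (algebraMap ℚ ℂ)).roots.toFinset := by
      intro z hz
      obtain ⟨ρ, hρ, rfl⟩ := Finset.mem_image.1 hz
      rw [Multiset.mem_toFinset, mem_roots hM'0, IsRoot.def]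
      exact hMroot ρ ((hZ ρ).1 hρ)
    calc e = Z.card := hZcard.symm
      _ = (Z.image (fun ρ : ℂ => ((x₀ : ℂ) + ρ) ^ (2 * m))).card := (Finset.card_image_of_injOn hinj).symm
      _ ≤ (M.map (algebraMap ℚ ℂ)).roots.toFinset.card := Finset.card_le_card himg
      _ ≤ Multiset.card (M.map (algebraMap ℚ ℂ)).roots := Multiset.toFinset_card_le _
      _ ≤ (M.map (algebraMap ℚ ℂ)).natDegree := card_roots' _
      _ = M.natDegree := natDegree_map_eq_of_injective (algebraMap ℚ ℂ).injective _
  have hann : ∀ f : Polynomial ℚ, aeval T₀ (f.map (algebraMap ℚ ℂ)) γ = 0 → M ∣ f := by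
    intro f hf; by_contra hnd
    obtain ⟨a, b, hab⟩ := (hMirr.coprime_iff_not_dvd).2 hnd
    have h1 : aeval T₀ ((a * M + b * f).map (algebraMap ℚ ℂ)) γ = γ := by
      rw [hab, Polynomial.map_one, aeval_one, Module.End.one_apply]
    rw [Polynomial.map_add, Polynomial.map_mul, Polynomial.map_mul, map_add, aeval_mul, aeval_mul,
      LinearMap.add_apply, Module.End.mul_apply, Module.End.mul_apply, hMW γ hγW, hf, map_zero, map_zero,
      add_zero] at h1
    exact hγ0 h1.symm
  -- the `deg M` rational classes `T₀ʲ γ` are `ℂ`-linearly independent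
  let s : ℕ := M.natDegree
  let v : Fin s → complexBetti A.X (2 * m) := fun j => (T₀ ^ (j : ℕ)) γ
  have hvQ : ∀ j, IsRationalClass (v j) := fun j => isRationalClass_pow_hom_complexBetti_map _ _ hγQ
  have hli : LinearIndependent ℂ v := by
    rw [Fintype.linearIndependent_iff]
    intro gc hgc j
    have hφ : ∀ ψ : ℂ →ₗ[ℚ] ℚ, ψ (gc j) = 0 := by
      intro ψ
      have h1 := sum_dual_smul_eq_zero_of_isRationalClass hvQ hgc ψ
      let f : Polynomial ℚ := ∑ i : Fin s, C (ψ (gc i)) * X ^ (i : ℕ)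
      have hf : aeval T₀ (f.map (algebraMap ℚ ℂ)) γ = 0 := by
        have : aeval T₀ (f.map (algebraMap ℚ ℂ)) γ = ∑ i : Fin s, ((ψ (gc i) : ℚ) : ℂ) • v i := by
          simp only [f, Polynomial.map_sum, Polynomial.map_mul, Polynomial.map_C, Polynomial.map_pow,
            Polynomial.map_X, map_sum, map_mul, aeval_C, map_pow, aeval_X, LinearMap.sum_apply,
            Module.End.mul_apply, Module.algebraMap_end_apply, eq_ratCast, v]
        rw [this]; exact h1
      have hf0 : f = 0 := Polynomial.eq_zero_of_dvd_of_degree_lt (hann f hf)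
        (by rw [Polynomial.degree_eq_natDegree hM0]; exact degree_sum_fin_lt _)
      have hcoeff : f.coeff j = ψ (gc j) := by
        simp only [f, finsetSum_coeff, coeff_C_mul_X_pow]
        rw [Finset.sum_eq_single j]
        · simp
        · intro i _ hij
          rw [if_neg (fun h => hij (Fin.ext h).symm)]
        · intro hj; exact absurd (Finset.mem_univ j) hj
      rw [← hcoeff, hf0, coeff_zero]
    exact (forall_dual_apply_eq_zero_iff ℚ (gc j)).1 hφ
  let Zs : Submodule ℂ (complexBetti A.X (2 * m)) := Submodule.span ℂ (Set.range v)
  have hZsW : Zs ≤ weilClassesField A φ P (2 * m) := Submodule.span_le.2 (by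
    rintro _ ⟨j, rfl⟩; exact pow_hom_complexBetti_map_mem_weilClassesField x₀ 1 j hγW)
  have hZsalg : Zs ≤ algebraicClasses A.X m := Submodule.span_le.2 (by
    rintro _ ⟨j, rfl⟩; exact pow_hom_complexBetti_map_mem_algebraicClasses _ j hγalg)
  have hZsrank : finrank ℂ Zs = s := by rw [finrank_span_eq_card hli, Fintype.card_fin]
  have hWrank : finrank ℂ (weilClassesField A φ P (2 * m)) = e :=
    finrank_weilClassesField_eq_natDegree hX φ hPe hPirr hφ her hr
  have hZsEq : Zs = weilClassesField A φ P (2 * m) :=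
    Submodule.eq_of_le_of_finrank_le hZsW (by rw [hWrank, hZsrank]; exact heM)
  exact hZsEq ▸ hZsalg

end OneClass

section Kappa

variable {A : AbelianVariety ℂ}

/-- **Markman's class statement, pointwise, for a field `F = ℚ(φ)` of ANY degree `e` ([Mar25b] §4).** With `A`, `φ`,
`P`, `e · 2m = 2 dim A` as in §1: if `κ` and `δ` are RATIONAL ALGEBRAIC classes of degree `2m` («since `κ_{d/2}(E)` and
`δ` do», `δ ∈ Im[Sym^{d/2}(𝒜²)]`) with `γ := κ − δ` a NON-ZERO class of `W_F ⊗ ℂ` (Condition (c)), then EVERY class of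
`W_F ⊗ ℂ = weilClassesField A φ P (2m)` is algebraic. [cite: Markman2025SurveySecant, §4 (pp. 9–10)]
[cite: MoonenZarhin1998WeilClasses, §1 (dim_F W_F = 1)] -/
theorem weilClassesField_le_algebraicClasses_of_kappa {φ : A ⟶ A} {P : Polynomial ℤ} {e m : ℕ}
    (hPe : P.natDegree = e) (hPirr : Irreducible (P.map (Int.castRingHom ℚ)))
    (hφ : Polynomial.eval₂ (Int.castRingHom (CategoryTheory.End A)) (φ : CategoryTheory.End A) P = 0)
    (her : e * (2 * m) = 2 * A.dim) (hm : 0 < m) {κ δ : complexBetti A.X (2 * m)}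
    (hκQ : IsRationalClass κ) (hκ : κ ∈ algebraicClasses A.X m) (hδQ : IsRationalClass δ)
    (hδ : δ ∈ algebraicClasses A.X m) (hγW : κ - δ ∈ weilClassesField A φ P (2 * m)) (hγ0 : κ - δ ≠ 0) :
    weilClassesField A φ P (2 * m) ≤ algebraicClasses A.X m := by
  have hγQ : IsRationalClass (κ - δ) := by
    have h := hκQ.add (hδQ.smul (-1 : ℚ))
    rwa [Rat.cast_neg, Rat.cast_one, neg_one_smul, ← sub_eq_add_neg] at h
  exact weilClassesField_le_algebraicClasses_of_isRationalClass_of_ne_zero hPe hPirr hφ her hm hγW hγQ hγ0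
    (Submodule.sub_mem _ hκ hδ)

end Kappa

end HodgeTheory

end Literature.AlgebraicGeometry.HodgeTheory

end
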